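import Literature.AlgebraicGeometry.GroupSchemes.BTGroupRingActionCompletion
import Literature.AlgebraicGeometry.GroupSchemes.BarsottiTateGroupFixedPartMap
import Literature.AlgebraicGeometry.AbelianSchemes.PDivisibleGroupRingAction
import Mathlib.RingTheory.Localization.AtPrime.Basic
import Mathlib.RingTheory.Localization.Ideal
import HarnessLib

/-!
# The `w`-torsion of the first layer of a Barsotti–Tate group with a ring action IS the uniformizer kernel of its `w`-block
# ([Tate 1967] §2 (2.1); [Rapoport–Smithling–Zhang 2020] §4.1 p. 17; [Harris–Taylor 2001] §II.1 p. 59)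

Topic `Literature/AlgebraicGeometry/GroupSchemes`; namespace `Literature.AlgebraicGeometry.GroupSchemes.IsRingActionBT`.  THEOREMS ONLY (no
definition, no named fact, no instance, no notation, no `sorry`).  Cell `hodgecm-mathlib` (D-0151), FLOOR 0, P6 «MOD programme» (crux hLiu418 =
stmt-HodgeConjecture-24832, `--supports`, count-neutral): K∕BT desk F0P6d-plan (g2), K∕BT CUT v2.2 junction organ **(O-J) «IDEAL TORSION = BLOCK
UNIFORMIZER KERNEL»** (memo `F0/P6/F0P6d-plan/KBT-CUT.v2p2.F0P6dplan-g2.md`).  P6a's D-4 types the block carrier at a special point as the IDEAL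
TORSION `A_x̄[𝔭]` of the first layer («killed by every `r ∈ 𝔭`», ★ `idealTuple` ∕ `GroupSchemeKernel.ker`), while the ★ P6b kit
`blockNumerics_of_line` is fed the BT block `Bw := Fix ε_𝔭` of `A_x̄[p^∞]` with its socket «the kernel of `(βw ϖ)₁` inside `(Bw)₁`».  This file is the
JUNCTION: on `T`-points of the first layer, «killed by every `r ∈ w`» ⟺ «lies in `Fix ε` and is killed by `βw ϖ`» (§3), the lift being unique.
The outputs of ★ (O-CRT) `BlockIdempotentFamily` and (O-LOC) `BTGroupBlock` (the localised action `βw` of `R_w` on `Fix ε` extending the restricted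
action) enter ONLY AS HYPOTHESES (`βw`, `hβw`, `hβwR`, `h1w : a 1 ≡ 1 (mod w)`, `ϖ` a generator of `𝔪_w`), so this file is import-disjoint from both;
§5 bridges to an ABELIAN SCHEME `A` with a ring action (★ DEAL 3 `PDivisibleGroupRingAction`: `B := A[p^∞]`, `β r := (act.i r)[p^∞]`).
HC_CM is proved only modulo the printed citations until rung 0 closes; nothing here is about HC.

THE MATHEMATICS.  `B` a Barsotti–Tate group over a field `k`, `β : R → End(B)` a ring action ([Tate1967] §2 (2.1): `End` acts layer-wise), `a : ℕ → R`
a compatible idempotent family (`a_{n+1} ≡ a_n`, `a_n² ≡ a_n (mod pⁿ)`; at a prime `w ∋ p` of `𝒪_F` the CRT family with `a_1 ≡ 1 (mod w)`,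
[RapoportSmithlingZhang2020Diagonal] §4.1 p. 17: `A[p^∞] = ∏_{w∣p} A[w^∞]` cut out by the idempotents of `𝒪_F ⊗ ℤ_p`), `ε := β(a)` the idempotent
endomorphism, `Bw := Fix ε` its fixed Barsotti–Tate group with inclusion `ι` and the localised action `βw : R_w → End(Bw)` (`βw ∘ algebraMap = `
restriction of `β`), `ϖ` with `𝔪_w R_w = (ϖ)`.  §1: a `T`-point `t` of `B₁` killed by every `β(r)`, `r ∈ w`, is FIXED by `ε₁ = β(a_1) = β(1)·β(a_1 − 1)`
(`a_1 − 1 ∈ w`).  §2: for a `T`-point `s` of `(Bw)₁`, `β(r)` acts on `ι s` as `βw(r∕1)` acts on `s` (`ι` mono and a homomorphism), and «`βw(r∕1) s = 1`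
for all `r ∈ w`» ⟺ «`βw(ϖ) s = 1`»: (⇐) `r∕1 ∈ 𝔪_w = (ϖ)`, so `r∕1 = c·ϖ` and `βw(cϖ) = βw(ϖ) ≫ βw(c)`; (⇒) `ϖ ∈ 𝔪_w = w·R_w` (Mathlib
`Localization.AtPrime.map_eq_maximalIdeal`), so `ϖ · (s′∕1) = r∕1` with `r ∈ w`, `s′ ∉ w` (`IsLocalization.mem_map_algebraMap_iff`), and `s′∕1` is a
UNIT of `R_w`, whence `ϖ = u⁻¹ · (r∕1)` and `βw(ϖ) = βw(r∕1) ≫ βw(u⁻¹)` kills `s`.  §3: combine with ★ `IdempotentSplitting.fixLift` (the universal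
property of `Fix ε₁`).  §5: for an abelian scheme `A → Spec R′` with ring action `act` and `p ∈ w`, a `T`-point of `A` killed by `act.i r`, `r ∈ w`, is killed
by `[p] = act.i p`, so lifts (uniquely) to the first layer `A[p] = (A[p^∞])₁` (★ `torsionLift`), where it is killed by every `(act.i r)[p^∞]₁` — §3's
left-hand side for `B := A[p^∞]` — and conversely (★ `torsionMap_ι`).

* §1 `comp_app_one_eq_self_of_forall_mem`; §2 `comp_fixBTGroupι_app_comp_app_eq`, `comp_fixBTGroupι_app_comp_app_eq_one_iff` (any layer `n`),
  **`forall_mem_iff_comp_app_eq_one`**; §3 HEAD **`forall_mem_comp_app_eq_one_iff_exists`**, `existsUnique_of_forall_mem_comp_app_eq_one`;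
  §5 (ns `…AbelianSchemes.AbelianSchemeOver.RingAction`) **`exists_torsionLift_forall_comp_app_eq_one`**, `forall_comp_torsionι_comp_i_eq_one`.

## References
* [Tate1967] J. T. Tate, *p-divisible groups*, Proc. Conf. Local Fields (Driebergen, 1966), Springer (1967), §2 (2.1)–(2.2).
* [RapoportSmithlingZhang2020Diagonal] M. Rapoport, B. Smithling, W. Zhang, *Arithmetic diagonal cycles on unitary Shimura varieties*, Compos. Math. 156
  (2020), §4.1 (p. 17) (`A[w^∞]`, `𝔭_w`-torsion).
* [HarrisTaylorAMS2001] M. Harris, R. Taylor, *The geometry and cohomology of some simple Shimura varieties*, Ann. of Math. Stud. 151 (2001), §II.1 (p. 59).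
* [GortzWedhorn2020] U. Görtz, T. Wedhorn, *Algebraic Geometry I* (2nd ed. 2020), Definition 4.45 (2) (p. 117) (kernels ∕ fixed subschemes as fibre products).
-/

set_option autoImplicit false

noncomputable section

universe u v

open CategoryTheory CategoryTheory.Limits AlgebraicGeometry MonoidalCategory CartesianMonoidalCategory
open scoped MonObj

namespace Literature.AlgebraicGeometry.GroupSchemes

namespace IsRingActionBT

open BTGroup BTGroup.Hom

section IdealTorsion

variable {k : Type u} [Field k] {p H : ℕ} {B : BTGroup (Spec (.of k)) p H} {R : Type v} [CommRing R] {β : R → BTGroup.Hom B B}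
  (hβ : IsRingActionBT B β) (a : ℕ → R) (ha : ∀ n, a (n + 1) - a n ∈ Ideal.span {(p : R) ^ n})
  (ha2 : ∀ n, a n * a n - a n ∈ Ideal.span {(p : R) ^ n}) (h₁ : ℕ)
  (hrank : ∀ n (s : Spec (.of k)), ((hβ.homOfCompatibleFamily a ha).fixLayer n).hom.finrank s = p ^ (n * h₁))
  (w : Ideal R) [w.IsPrime]

/-! ### §1 A point killed by `w` is fixed by `ε = β(a)` on the first layer (`a 1 ≡ 1 (mod w)`) -/

omit [w.IsPrime] in
/-- **§1 — killed by `w` ⟹ fixed by `ε₁`.**  If `a 1 ≡ 1 (mod w)` and the `T`-point `t` of the first layer `B₁` is killed by every `β r`, `r ∈ w`,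
then `t ≫ ε₁ = t` for `ε = β(a)` (`ε₁ = β(a 1) = β(a 1 − 1) · β(1)` by additivity, ★ `IsRingActionBT.app_add'`, and `β(1) = 𝟙`).
[cite: Tate1967, §2 (2.1)] [cite: RapoportSmithlingZhang2020Diagonal, §4.1 (p. 17)] -/
theorem comp_app_one_eq_self_of_forall_mem (h1w : a 1 - 1 ∈ w) {T : Over (Spec (.of k))} (t : T ⟶ B.G 1)
    (ht : ∀ r ∈ w, t ≫ (β r).app 1 = (letI := B.grpObj 1; (1 : T ⟶ B.G 1))) :
    t ≫ (hβ.homOfCompatibleFamily a ha).app 1 = t := by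
  letI := B.grpObj 1
  rw [homOfCompatibleFamily_app, ← sub_add_cancel (a 1) 1, hβ.app_add' (a 1 - 1) 1 1, MonObj.comp_mul, ht _ h1w, one_mul,
    hβ.app_one, Category.comp_id]

/-! ### §2 On the block: «killed by every `r ∈ w`» ⟺ «killed by the uniformizer `ϖ` of `R_w`» -/

variable (βw : Localization.AtPrime w →
    BTGroup.Hom ((hβ.homOfCompatibleFamily a ha).fixBTGroup (hβ.homOfCompatibleFamily_idem a ha ha2) h₁ hrank)
      ((hβ.homOfCompatibleFamily a ha).fixBTGroup (hβ.homOfCompatibleFamily_idem a ha ha2) h₁ hrank))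
  (hβw : IsRingActionBT ((hβ.homOfCompatibleFamily a ha).fixBTGroup (hβ.homOfCompatibleFamily_idem a ha ha2) h₁ hrank) βw)
  (hβwR : ∀ r : R, βw (algebraMap R (Localization.AtPrime w) r) =
    fixRestrict (hβ.homOfCompatibleFamily a ha) (hβ.homOfCompatibleFamily_idem a ha ha2) h₁ hrank (hβ.homOfCompatibleFamily a ha)
      (hβ.homOfCompatibleFamily_idem a ha ha2) h₁ hrank (β r) (fun n => hβ.app_comm r (a n) n))
  (ϖ : Localization.AtPrime w) (hϖ : IsLocalRing.maximalIdeal (Localization.AtPrime w) = Ideal.span {ϖ})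

include hβwR in
/-- **`β r` acts on `ι s` as `βw (r∕1)` acts on `s`**: `(s ≫ ι_n) ≫ (β r)_n = (s ≫ (βw (r∕1))_n) ≫ ι_n` (`βw ∘ algebraMap` is the restriction of `β`,
★ `fixRestrict_app_comp_fixLayerι`). [cite: Tate1967, §2 (2.1)] -/
theorem comp_fixBTGroupι_app_comp_app_eq {T : Over (Spec (.of k))} (n : ℕ)
    (s : T ⟶ ((hβ.homOfCompatibleFamily a ha).fixBTGroup (hβ.homOfCompatibleFamily_idem a ha ha2) h₁ hrank).G n) (r : R) :
    (s ≫ ((hβ.homOfCompatibleFamily a ha).fixBTGroupι (hβ.homOfCompatibleFamily_idem a ha ha2) h₁ hrank).app n) ≫ (β r).app n =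
      (s ≫ (βw (algebraMap R (Localization.AtPrime w) r)).app n) ≫
        ((hβ.homOfCompatibleFamily a ha).fixBTGroupι (hβ.homOfCompatibleFamily_idem a ha ha2) h₁ hrank).app n := by
  rw [hβwR r, Category.assoc, Category.assoc, fixBTGroupι_app, fixRestrict_app_comp_fixLayerι]
  rfl

include hβwR in
/-- **`β r` kills `ι s` iff `βw (r∕1)` kills `s`** (any layer `n`; `ι_n` is a monomorphism and a homomorphism). [cite: Tate1967, §2 (2.1)]
[cite: GortzWedhorn2020, Definition 4.45 (2) (p. 117)] -/
theorem comp_fixBTGroupι_app_comp_app_eq_one_iff {T : Over (Spec (.of k))} (n : ℕ)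
    (s : T ⟶ ((hβ.homOfCompatibleFamily a ha).fixBTGroup (hβ.homOfCompatibleFamily_idem a ha ha2) h₁ hrank).G n) (r : R) :
    (s ≫ ((hβ.homOfCompatibleFamily a ha).fixBTGroupι (hβ.homOfCompatibleFamily_idem a ha ha2) h₁ hrank).app n) ≫ (β r).app n =
        (letI := B.grpObj n; (1 : T ⟶ B.G n)) ↔
      s ≫ (βw (algebraMap R (Localization.AtPrime w) r)).app n =
        (letI := ((hβ.homOfCompatibleFamily a ha).fixBTGroup (hβ.homOfCompatibleFamily_idem a ha ha2) h₁ hrank).grpObj n;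
          (1 : T ⟶ ((hβ.homOfCompatibleFamily a ha).fixBTGroup (hβ.homOfCompatibleFamily_idem a ha ha2) h₁ hrank).G n)) := by
  letI := B.grpObj n
  letI := ((hβ.homOfCompatibleFamily a ha).fixBTGroup (hβ.homOfCompatibleFamily_idem a ha ha2) h₁ hrank).grpObj n
  haveI : Mono (((hβ.homOfCompatibleFamily a ha).fixBTGroupι (hβ.homOfCompatibleFamily_idem a ha ha2) h₁ hrank).app n) :=
    (hβ.homOfCompatibleFamily a ha).mono_fixLayerι n
  haveI : IsMonHom (((hβ.homOfCompatibleFamily a ha).fixBTGroupι (hβ.homOfCompatibleFamily_idem a ha ha2) h₁ hrank).app n) :=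
    (hβ.homOfCompatibleFamily a ha).isMonHom_fixLayerι n
  rw [hβ.comp_fixBTGroupι_app_comp_app_eq a ha ha2 h₁ hrank w βw hβwR n s r]
  constructor
  · intro h
    rw [← cancel_mono (((hβ.homOfCompatibleFamily a ha).fixBTGroupι (hβ.homOfCompatibleFamily_idem a ha ha2) h₁ hrank).app n), h,
      MonObj.one_comp]
  · intro h
    rw [h, MonObj.one_comp]

include hβw hβwR hϖ in
/-- **§2 — on the block, «killed by every `r ∈ w`» ⟺ «killed by the uniformizer `ϖ`».**  For a `T`-point `s` of `(Fix ε)₁`: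
`(∀ r ∈ w, (s ≫ ι₁) ≫ (β r)₁ = 1) ↔ s ≫ (βw ϖ)₁ = 1`.  (⇐) `r∕1 ∈ 𝔪_w = (ϖ)`: `r∕1 = c ϖ`, `βw (c ϖ) = βw ϖ ≫ βw c`; (⇒) `ϖ ∈ 𝔪_w = w R_w`
(Mathlib `Localization.AtPrime.map_eq_maximalIdeal`, `IsLocalization.mem_map_algebraMap_iff`): `ϖ · (s′∕1) = r∕1` with `r ∈ w`, `s′ ∉ w`, and `s′∕1` is a
unit `u`, so `ϖ = u⁻¹ (r∕1)` and `βw ϖ = βw (r∕1) ≫ βw u⁻¹` kills `s`. [cite: Tate1967, §2 (2.1)] [cite: RapoportSmithlingZhang2020Diagonal, §4.1 (p. 17)]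
[cite: HarrisTaylorAMS2001, §II.1 (p. 59)] -/
theorem forall_mem_iff_comp_app_eq_one {T : Over (Spec (.of k))}
    (s : T ⟶ ((hβ.homOfCompatibleFamily a ha).fixBTGroup (hβ.homOfCompatibleFamily_idem a ha ha2) h₁ hrank).G 1) :
    (∀ r ∈ w, (s ≫ ((hβ.homOfCompatibleFamily a ha).fixBTGroupι (hβ.homOfCompatibleFamily_idem a ha ha2) h₁ hrank).app 1) ≫ (β r).app 1 =
        (letI := B.grpObj 1; (1 : T ⟶ B.G 1))) ↔
      s ≫ (βw ϖ).app 1 =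
        (letI := ((hβ.homOfCompatibleFamily a ha).fixBTGroup (hβ.homOfCompatibleFamily_idem a ha ha2) h₁ hrank).grpObj 1;
          (1 : T ⟶ ((hβ.homOfCompatibleFamily a ha).fixBTGroup (hβ.homOfCompatibleFamily_idem a ha ha2) h₁ hrank).G 1)) := by
  letI := ((hβ.homOfCompatibleFamily a ha).fixBTGroup (hβ.homOfCompatibleFamily_idem a ha ha2) h₁ hrank).grpObj 1
  simp_rw [hβ.comp_fixBTGroupι_app_comp_app_eq_one_iff a ha ha2 h₁ hrank w βw hβwR 1 s]
  constructor
  · -- `ϖ ∈ 𝔪_w = w·R_w`: `ϖ * algebraMap s' = algebraMap r` with `r ∈ w`, `s' ∉ w`, and `algebraMap s'` is a unit of `R_w`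
    intro h
    have hϖmem : ϖ ∈ Ideal.map (algebraMap R (Localization.AtPrime w)) w := by
      rw [Localization.AtPrime.map_eq_maximalIdeal, hϖ]
      exact Ideal.mem_span_singleton_self ϖ
    obtain ⟨⟨⟨r, hr⟩, ⟨s', hs'⟩⟩, hrs⟩ :=
      (IsLocalization.mem_map_algebraMap_iff w.primeCompl (Localization.AtPrime w)).mp hϖmem
    change ϖ * algebraMap R (Localization.AtPrime w) s' = algebraMap R (Localization.AtPrime w) r at hrs
    obtain ⟨u, hu⟩ := IsLocalization.map_units (Localization.AtPrime w) (⟨s', hs'⟩ : w.primeCompl)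
    change (u : Localization.AtPrime w) = algebraMap R (Localization.AtPrime w) s' at hu
    have hϖeq : ϖ = ↑u⁻¹ * algebraMap R (Localization.AtPrime w) r := by
      rw [← hrs, ← hu, mul_comm ϖ (u : Localization.AtPrime w), ← mul_assoc, Units.inv_mul, one_mul]
    haveI := (βw (↑u⁻¹ : Localization.AtPrime w)).isMonHom_app 1
    rw [hϖeq, hβw.map_mul, comp_app, ← Category.assoc, h r hr, MonObj.one_comp]
  · -- `algebraMap r ∈ 𝔪_w = (ϖ)`: `algebraMap r = c * ϖ`
    intro h r hr
    have hmem : algebraMap R (Localization.AtPrime w) r ∈ Ideal.span {ϖ} := by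
      rw [← hϖ, ← Localization.AtPrime.map_eq_maximalIdeal]
      exact Ideal.mem_map_of_mem _ hr
    obtain ⟨c, hc⟩ := Ideal.mem_span_singleton'.mp hmem
    haveI := (βw c).isMonHom_app 1
    rw [← hc, hβw.map_mul, comp_app, ← Category.assoc, h, MonObj.one_comp]

/-! ### §3 HEAD — the `w`-torsion of the first layer is the block's `ϖ`-kernel, pushed forward along `ι` -/

include hβw hβwR hϖ in
/-- **§3 HEAD — THE `w`-TORSION OF THE FIRST LAYER IS THE BLOCK'S `ϖ`-KERNEL PUSHED FORWARD ALONG `ι`.**  For a `T`-point `t` of `B₁`: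
`(∀ r ∈ w, t ≫ (β r)₁ = 1) ↔ ∃ s : T ⟶ (Fix ε)₁, s ≫ ι₁ = t ∧ s ≫ (βw ϖ)₁ = 1` (`s = fixLift ε₁ t` by §1, ★ `IdempotentSplitting.fixLift`; then §2).
DOCKING: P6a's `G₀ x̄ = A_x̄[𝔭]` (ideal torsion of the first layer) ↔ the P6b kit's socket `G := ker ((βw ϖ).app 1)`, `ιG := kerι`.
[cite: Tate1967, §2 (2.1)] [cite: RapoportSmithlingZhang2020Diagonal, §4.1 (p. 17)] [cite: HarrisTaylorAMS2001, §II.1 (p. 59)] -/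
theorem forall_mem_comp_app_eq_one_iff_exists (h1w : a 1 - 1 ∈ w) {T : Over (Spec (.of k))} (t : T ⟶ B.G 1) :
    (∀ r ∈ w, t ≫ (β r).app 1 = (letI := B.grpObj 1; (1 : T ⟶ B.G 1))) ↔
      ∃ s : T ⟶ ((hβ.homOfCompatibleFamily a ha).fixBTGroup (hβ.homOfCompatibleFamily_idem a ha ha2) h₁ hrank).G 1,
        s ≫ ((hβ.homOfCompatibleFamily a ha).fixBTGroupι (hβ.homOfCompatibleFamily_idem a ha ha2) h₁ hrank).app 1 = t ∧
          s ≫ (βw ϖ).app 1 =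
            (letI := ((hβ.homOfCompatibleFamily a ha).fixBTGroup (hβ.homOfCompatibleFamily_idem a ha ha2) h₁ hrank).grpObj 1;
              (1 : T ⟶ ((hβ.homOfCompatibleFamily a ha).fixBTGroup (hβ.homOfCompatibleFamily_idem a ha ha2) h₁ hrank).G 1)) := by
  letI := B.grpObj 1
  constructor
  · intro ht
    refine ⟨IdempotentSplitting.fixLift ((hβ.homOfCompatibleFamily a ha).app 1) t
        (hβ.comp_app_one_eq_self_of_forall_mem a ha w h1w t ht), ?_, ?_⟩
    · exact IdempotentSplitting.fixLift_ι _ t _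
    · rw [← hβ.forall_mem_iff_comp_app_eq_one a ha ha2 h₁ hrank w βw hβw hβwR ϖ hϖ]
      intro r hr
      rw [fixBTGroupι_app]
      change (IdempotentSplitting.fixLift ((hβ.homOfCompatibleFamily a ha).app 1) t _ ≫
        IdempotentSplitting.fixι ((hβ.homOfCompatibleFamily a ha).app 1)) ≫ (β r).app 1 = 1
      rw [IdempotentSplitting.fixLift_ι]
      exact ht r hr
  · rintro ⟨s, hst, hs⟩ r hr
    rw [← hst]
    exact ((hβ.forall_mem_iff_comp_app_eq_one a ha ha2 h₁ hrank w βw hβw hβwR ϖ hϖ s).mpr hs) r hr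

include hβw hβwR hϖ in
/-- The lift of §3 is UNIQUE (`ι₁` is a monomorphism): a `T`-point of `B₁` killed by `w` has exactly one preimage in `(Fix ε)₁`, and it is killed by
`βw ϖ`. [cite: Tate1967, §2 (2.1)] [cite: GortzWedhorn2020, Definition 4.45 (2) (p. 117)] -/
theorem existsUnique_of_forall_mem_comp_app_eq_one (h1w : a 1 - 1 ∈ w) {T : Over (Spec (.of k))} (t : T ⟶ B.G 1)
    (ht : ∀ r ∈ w, t ≫ (β r).app 1 = (letI := B.grpObj 1; (1 : T ⟶ B.G 1))) :
    ∃! s : T ⟶ ((hβ.homOfCompatibleFamily a ha).fixBTGroup (hβ.homOfCompatibleFamily_idem a ha ha2) h₁ hrank).G 1,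
      s ≫ ((hβ.homOfCompatibleFamily a ha).fixBTGroupι (hβ.homOfCompatibleFamily_idem a ha ha2) h₁ hrank).app 1 = t ∧
        s ≫ (βw ϖ).app 1 =
          (letI := ((hβ.homOfCompatibleFamily a ha).fixBTGroup (hβ.homOfCompatibleFamily_idem a ha ha2) h₁ hrank).grpObj 1;
            (1 : T ⟶ ((hβ.homOfCompatibleFamily a ha).fixBTGroup (hβ.homOfCompatibleFamily_idem a ha ha2) h₁ hrank).G 1)) := by
  obtain ⟨s, hs⟩ := (hβ.forall_mem_comp_app_eq_one_iff_exists a ha ha2 h₁ hrank w βw hβw hβwR ϖ hϖ h1w t).mp ht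
  refine ⟨s, hs, fun s' hs' => ?_⟩
  haveI : Mono (((hβ.homOfCompatibleFamily a ha).fixBTGroupι (hβ.homOfCompatibleFamily_idem a ha ha2) h₁ hrank).app 1) :=
    (hβ.homOfCompatibleFamily a ha).mono_fixLayerι 1
  rw [← cancel_mono (((hβ.homOfCompatibleFamily a ha).fixBTGroupι (hβ.homOfCompatibleFamily_idem a ha ha2) h₁ hrank).app 1),
    hs'.1, hs.1]

end IdealTorsion

end IsRingActionBT

/-! ### §5 A-level bridge: the `w`-torsion of an abelian scheme `A` lives in the first layer `A[p]` of `A[p^∞]` and is killed there by `β(w)` -/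

end Literature.AlgebraicGeometry.GroupSchemes

namespace Literature.AlgebraicGeometry.AbelianSchemes.AbelianSchemeOver.RingAction

open Literature.AlgebraicGeometry.AbelianSchemes Literature.AlgebraicGeometry.AbelianSchemes.AbelianSchemeOver
open Literature.AlgebraicGeometry.GroupSchemes

variable {R' : Type u} [CommRing R'] {A : AbelianSchemeOver (Spec (.of R'))} [IsCommMonObj A.X] {O : Type v} [CommRing O]
  (act : RingAction O A) {p g : ℕ} (hp : p ≠ 0) (hg : A.IsOfRelDim g) (w : Ideal O)

/-- **§5 — DOWN TO THE FIRST LAYER.**  `A → Spec R′` an abelian scheme with a ring action `act`, `p ∈ w`.  A `T`-point `t` of `A` killed by every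
`act.i r`, `r ∈ w`, is killed by `[p] = act.i p` and hence factors (uniquely) through the first layer `A[p] = (A[p^∞])₁` (★ `torsionLift`); its lift
`t₁` is killed by every `(act.i r)[p^∞]₁`, `r ∈ w` — the LHS of §3 for `B := A[p^∞]`, `β r := (act.i r)[p^∞]` (★ DEAL 3 `pDivisibleGroupMap`,
`isRingActionBT_pDivisibleGroupMap`).  [cite: Tate1967, §2 (2.1)–(2.2)] [cite: RapoportSmithlingZhang2020Diagonal, §4.1 (p. 17)] -/
theorem exists_torsionLift_forall_comp_app_eq_one (hpw : (p : O) ∈ w) {T : Over (Spec (.of R'))} (t : T ⟶ A.X)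
    (ht : ∀ r ∈ w, t ≫ act.i r = 1) :
    ∃ t₁ : T ⟶ (A.pDivisibleGroup hp hg).G 1, t₁ ≫ A.torsionι (p ^ 1) = t ∧
      ∀ r ∈ w, t₁ ≫ (haveI := act.isMonHom_i r; pDivisibleGroupMap (act.i r) hp hg hg).app 1 =
        (letI := (A.pDivisibleGroup hp hg).grpObj 1; (1 : T ⟶ (A.pDivisibleGroup hp hg).G 1)) := by
  -- `t ≫ [p] = t ≫ act.i p = 1`
  have htp : t ≫ A.mulN (p ^ 1) = 1 := by
    have h := ht (p : O) hpw
    rw [← Nat.smul_one_eq_cast, act.i_nsmul, act.i_one] at h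
    rwa [pow_one, mulN_def]
  refine ⟨A.torsionLift t htp, A.torsionLift_ι t htp, fun r hr => ?_⟩
  haveI := act.isMonHom_i r
  letI := A.torsionGrpObj (p ^ 1)
  haveI : IsMonHom (A.torsionι (p ^ 1)) := A.isMonHom_torsionι (p ^ 1)
  show A.torsionLift t htp ≫ torsionMap (act.i r) (p ^ 1) = (1 : T ⟶ A.torsion (p ^ 1))
  apply A.torsion_hom_ext
  rw [Category.assoc, torsionMap_ι, ← Category.assoc, A.torsionLift_ι t htp, ht r hr, MonObj.one_comp]

/-- **§5, converse direction**: a `T`-point `t₁` of the first layer killed by every `(act.i r)[p^∞]₁`, `r ∈ w`, maps to a `T`-point `t₁ ≫ ι` of `A`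
killed by every `act.i r`, `r ∈ w`. [cite: Tate1967, §2 (2.1)–(2.2)] -/
theorem forall_comp_torsionι_comp_i_eq_one {T : Over (Spec (.of R'))} (t₁ : T ⟶ (A.pDivisibleGroup hp hg).G 1)
    (ht₁ : ∀ r ∈ w, t₁ ≫ (haveI := act.isMonHom_i r; pDivisibleGroupMap (act.i r) hp hg hg).app 1 =
      (letI := (A.pDivisibleGroup hp hg).grpObj 1; (1 : T ⟶ (A.pDivisibleGroup hp hg).G 1))) :
    ∀ r ∈ w, (t₁ ≫ A.torsionι (p ^ 1)) ≫ act.i r = 1 := by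
  intro r hr
  haveI := act.isMonHom_i r
  letI := A.torsionGrpObj (p ^ 1)
  haveI : IsMonHom (A.torsionι (p ^ 1)) := A.isMonHom_torsionι (p ^ 1)
  -- read `t₁` as a point of `A[p] = A.torsion (p ^ 1)` (the first layer of `A[p^∞]`, definitionally)
  have h1 : CategoryStruct.comp (Y := A.torsion (p ^ 1)) t₁ (torsionMap (act.i r) (p ^ 1)) = (1 : T ⟶ A.torsion (p ^ 1)) :=
    ht₁ r hr
  show CategoryStruct.comp (Y := A.torsion (p ^ 1)) t₁ (A.torsionι (p ^ 1)) ≫ act.i r = (1 : T ⟶ A.X)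
  rw [Category.assoc, ← torsionMap_ι (act.i r) (p ^ 1), ← Category.assoc, h1, MonObj.one_comp]

end Literature.AlgebraicGeometry.AbelianSchemes.AbelianSchemeOver.RingAction

end
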